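import Summits.HodgeConjecture.HodgeConjecture.Theorems.MarkmanPartnerTransportPicardThreeK3SquaresCycleInducedSector
import Summits.HodgeConjecture.HodgeConjecture.Theorems.AnchorTransportAnchorExistenceK3SquareCMFloor
import Summits.HodgeConjecture.HodgeConjecture.Theses.MarkmanPartnerTransport
import Literature.AlgebraicGeometry.HodgeTheory.SupportedClassesHodgeConiveauHolds
import Literature.AlgebraicGeometry.HodgeTheory.LefschetzOneOneHolds
import Literature.AlgebraicGeometry.HodgeTheory.KunnethCrossProductsSpanProofs

/-!
# Route MarkmanPartnerTransport · crux `PicardThreeK3Squares` (stmt-HodgeConjecture-19652) —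
# the CM third from Buskin's isometry theorem, and the crux reduced to its real-multiplication third

Zarhin's trichotomy for a projective K3 surface `S`: `E = End_Hdg(T(S)_ℚ)` is a CM field, `ℚ`, or a
totally real field `≠ ℚ` (real multiplication). The crux `PicardThreeK3Squares` (HC⁴ of `S × S`,
`ρ(S) ≥ 3`) is known on the first two thirds; this file records both in the tree's vocabulary and
isolates the third:

* `hodgeConjectureFor_square_of_CM_of_buskin` — **the named fact
  `Buskin2019_hodgeConjectureFor_square_of_CM` (Buskin's Corollary / Huybrechts 2019 Cor. 0.4 (ii):
  HC for `S × S`, `S` a CM K3 surface) DERIVED from Buskin's Thm. 1.1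
  (`Buskin2019_hodgeIsometry_algebraic`: rational Hodge isometries of K3 surfaces are algebraic) and
  the existence of markings (`Huybrechts_K3_marking_exists`)** — "reduce squares to isometry
  classes": the CM floor of route AnchorTransport (`anchorExistence_cmFloor_algebraicClass_of_endomorphism`:
  on a CM K3 surface every rational Hodge endomorphism of `H²` is `[Γ]_*` with `Γ` algebraic, by
  Zarhin's span-by-isometries theorem in the marking picture and Buskin's Thm. 1.1) fed into the
  marking-free, `b₁`-free bookkeeping `hodgeConjectureFor_square_of_cycleInducedSector`; the inputs
  Lefschetz `(1,1)`, `N¹ ⊆ F¹`, Hodge index, `Huybrechts_K3_hodgeTypes_H2` are tree theorems, and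
  `b₁ = 0` (`Huybrechts_K3_oddBetti_vanish`, needed by the AnchorTransport floor) is NOT used.
* `picardThreeK3Squares_of_realMultiplicationThird` — **the crux from its RM third**: granted
  Buskin's Thm. 1.1 and markings, `PicardThreeK3Squares` follows from the single statement "for every
  projective K3 surface `S` with `ρ(S) ≥ 3`, not CM and with `End_Hdg(T(S)) ≠ ℚ`, every rational Hodge
  endomorphism of `H²(S)` killing `N¹` with image in `T` agrees on `T` with an `N¹`-stable
  endomorphism induced by an algebraic class on `S × S`" (the cycle-induced sector clause; the
  `E = ℚ` third is the tree theorem `hodgeConjectureFor_square_of_hodgeEndomorphisms_scalar`).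
  The van Geemen–Schütt families satisfy the clause (`Theorems/…SquareOfGenerator`); the general
  member of a maximal RM family is the open core.

No definition, no sorry; named facts only as hypotheses. Prover seat hodge-nonav-19652-p1 (gen 0),
`--supports stmt-HodgeConjecture-19652`.

References: Buskin, J. reine angew. Math. 755 (2019), Thm. 1.1 and Corollary; Huybrechts, Comment.
Math. Helv. 94 (2019), Cor. 0.4 (ii); Huybrechts, *Lectures on K3 Surfaces*, Thm. 3.3.7; Zarhin, J.
reine angew. Math. 341 (1983), Thm. 1.5.1; Varesco (2023), §2 p. 8.
-/

set_option linter.dupNamespace false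

noncomputable section

namespace Summit.HodgeConjecture.HodgeConjecture.Theorems.MarkmanPartnerTransport.CMThird

open scoped Manifold
open CategoryTheory MonoidalCategory CartesianMonoidalCategory
open Literature.AlgebraicGeometry Literature.AlgebraicGeometry.Motives Literature.AlgebraicGeometry.HodgeTheory
open Literature.AlgebraicGeometry.Surfaces
open Literature.AlgebraicTopology.SingularHomology
open Summit.HodgeConjecture.HodgeConjecture.Theorems
open Summit.HodgeConjecture.HodgeConjecture.Theorems.NikulinTwinTransport
open Summit.HodgeConjecture.HodgeConjecture.Theorems.MarkmanPartnerTransport.CycleInducedSector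

variable {S : SchemeOver ℂ}

/-- `Corr[μ, hS ; γ, y] = pr₁_*(pr₂^* y ∪ γ)` on `H²(S(ℂ); ℂ)`. Local notation only. -/
local notation3 (prettyPrint := false) "Corr[" μ ", " hS " ; " γ ", " y "]" =>
  complexGysin μ (IsSmoothProjective.tensor_holds hS hS) hS
    (SemiCartesianMonoidalCategory.fst _ _) (rfl : 2 * 1 + 2 * 2 + 2 * 2 = 2 * 1 + 2 * (2 + 2))
    (cupProduct (rfl : 2 * 1 + 2 * 2 = 2 * 1 + 2 * 2)
      (complexBetti.map (SemiCartesianMonoidalCategory.snd _ _) (2 * 1) y) γ)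

/-! ### The CM third: Buskin's corollary from Buskin's theorem -/

/-- **On a CM K3 surface the cycle-induced sector clause holds**, granted Buskin's Thm. 1.1 and
markings: every rational type-preserving endomorphism `f` of `H²(S(ℂ); ℂ)` killing `N¹` is `[Γ]_*`
for an algebraic `Γ` on `S × S` (`anchorExistence_cmFloor_algebraicClass_of_endomorphism`, with its
inputs Lefschetz `(1,1)`, `N¹ ⊆ F¹`, Hodge index, K3 Hodge types and Künneth supplied by tree
theorems), so `g := f` is an `N¹`-stable (`f` kills `N¹`) cycle-induced endomorphism agreeing with
`f`. [cite: Buskin2019, Thm. 1.1 and the Corollary after it] [cite: Huybrechts2016K3, Thm. 3.3.7] -/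
theorem cycleInducedSector_of_CM (hB : Buskin2019_hodgeIsometry_algebraic)
    (hmark : Huybrechts_K3_marking_exists) (μ : OrientationFamily) (hS : IsK3Surface S)
    (hCM : HasComplexMultiplication S) :
    ∀ (f : complexBetti S (2 * 1) →ₗ[ℂ] complexBetti S (2 * 1)),
      (∀ y, IsRationalClass y → IsRationalClass (f y)) →
      (∀ (i j : ℕ) y, IsOfHodgeType 2 S (2 * 1) i j y → IsOfHodgeType 2 S (2 * 1) i j (f y)) →
      (∀ d ∈ algebraicClasses S 1, f d = 0) →
      (∀ y : complexBetti S (2 * 1), ∀ d ∈ algebraicClasses S 1,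
        cupProduct (rfl : 2 * 1 + 2 * 1 = 2 * 2) (f y) d = 0) →
      ∃ g : complexBetti S (2 * 1) →ₗ[ℂ] complexBetti S (2 * 1),
        (∀ d ∈ algebraicClasses S 1, g d ∈ algebraicClasses S 1) ∧
        (∃ γ ∈ algebraicClasses (S ⊗ S) 2, ∀ y : complexBetti S (2 * 1),
          g y = Corr[μ, hS.isSmoothProjective ; γ, y]) ∧
        ∀ y : complexBetti S (2 * 1),
          (∀ d ∈ algebraicClasses S 1, cupProduct (rfl : 2 * 1 + 2 * 1 = 2 * 2) y d = 0) →
            f y = g y := by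
  intro f hf_rat hf_typ hf_N _
  have hL11 : ∀ c : complexBetti S (2 * 1), IsRationalClass c → IsOfHodgeType 2 S (2 * 1) 1 1 c →
      c ∈ algebraicClasses S 1 := fun c hc h11 ↦ lefschetzOneOne_rational_holds hS.1 c hc h11
  have hND : ∀ c ∈ algebraicClasses S 1, IsRationalClass c →
      (∀ d ∈ algebraicClasses S 1, cupProduct (rfl : 2 * 1 + 2 * 1 = 2 * 2) c d = 0) → c = 0 :=
    fun c hcN hc hperp ↦ anchorExistence_cmFloor_divisorClass_eq_zero_of_hodgeIndex
      hodgeIndex_surface_holds lefschetzOneOne_rational_holds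
      Grothendieck1969_supportedClasses_le_hodgeConiveau_holds hS hcN hc hperp
  obtain ⟨Γ, hΓalg, hΓ⟩ := anchorExistence_cmFloor_algebraicClass_of_endomorphism hB hmark
    Huybrechts_K3_hodgeTypes_H2_holds Grothendieck1969_supportedClasses_le_hodgeConiveau_holds μ hS hCM
    (Hatcher2002_crossProducts_span_complexBetti_holds hS.1 hS.1 _) hL11 hND f hf_rat hf_typ
  refine ⟨f, fun d hd ↦ ?_, ⟨Γ, hΓalg, hΓ⟩, fun y _ ↦ rfl⟩
  rw [hf_N d hd]
  exact Submodule.zero_mem _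

/-- **Buskin's Corollary (= Huybrechts 2019, Cor. 0.4 (ii)) from Buskin's Theorem 1.1: the Hodge
conjecture for the square of a CM K3 surface** — the tree's named fact
`Buskin2019_hodgeConjectureFor_square_of_CM`, DERIVED from `Buskin2019_hodgeIsometry_algebraic` and
`Huybrechts_K3_marking_exists`: `End_Hdg(T(S)_ℚ)` is a CM field spanned by Hodge isometries (Zarhin /
Ramón-Marí, in the tree), which are algebraic (Thm. 1.1), so the cycle-induced sector clause holds
(`cycleInducedSector_of_CM`) and the marking-free bookkeeping
`hodgeConjectureFor_square_of_cycleInducedSector` gives HC in every codimension. (`b₁ = 0` is not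
used.) [cite: Buskin2019, Corollary (Introduction, after Thm. 1.1)] [cite: Huybrechts2019, Cor. 0.4 (ii)] -/
theorem hodgeConjectureFor_square_of_CM_of_buskin (hB : Buskin2019_hodgeIsometry_algebraic)
    (hmark : Huybrechts_K3_marking_exists) : Buskin2019_hodgeConjectureFor_square_of_CM :=
  fun _ hS hCM ↦ hodgeConjectureFor_square_of_cycleInducedSector complexOrientationFamily
    hS.isSmoothProjective (cycleInducedSector_of_CM hB hmark complexOrientationFamily hS hCM)

/-! ### The crux from its real-multiplication third -/

/-- **`PicardThreeK3Squares` from its real-multiplication third.** Granted Buskin's Thm. 1.1 and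
markings, the crux (HC⁴ of `S × S` for every marked projective K3 surface `S` with `ρ(S) ≥ 3`)
follows from the cycle-induced sector clause on the RM third alone: for every K3 surface `S` with
`3 ≤ ρ(S)` which is NOT of CM type and whose rational Hodge endomorphisms killing `N¹` with image in
`T` are NOT all rational scalars on `T` (`End_Hdg(T(S)) ≠ ℚ`), every such endomorphism agrees on `T`
with an `N¹`-stable endomorphism induced by an algebraic class on `S × S` (for the complex
orientation family). Trichotomy by logic: CM ⇒ `hodgeConjectureFor_square_of_CM_of_buskin`; scalar ⇒
`hodgeConjectureFor_square_of_hodgeEndomorphisms_scalar`; else `hRM` and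
`hodgeConjectureFor_square_of_cycleInducedSector`. [cite: Zarhin1983HodgeGroupsK3, Thm. 1.5.1]
[cite: Varesco2023, §2 (p. 8)] [cite: Buskin2019, Thm. 1.1] -/
theorem picardThreeK3Squares_of_realMultiplicationThird (hB : Buskin2019_hodgeIsometry_algebraic)
    (hmark : Huybrechts_K3_marking_exists)
    (hRM : ∀ (S : SchemeOver ℂ) (hS : IsK3Surface S), ¬ HasComplexMultiplication S →
      3 ≤ Module.finrank ℂ ↥(algebraicClasses S 1) →
      (¬ ∀ (f : complexBetti S (2 * 1) →ₗ[ℂ] complexBetti S (2 * 1)),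
        (∀ y, IsRationalClass y → IsRationalClass (f y)) →
        (∀ (i j : ℕ) y, IsOfHodgeType 2 S (2 * 1) i j y → IsOfHodgeType 2 S (2 * 1) i j (f y)) →
        (∀ d ∈ algebraicClasses S 1, f d = 0) →
        (∀ y : complexBetti S (2 * 1), ∀ d ∈ algebraicClasses S 1,
          cupProduct (rfl : 2 * 1 + 2 * 1 = 2 * 2) (f y) d = 0) →
        ∃ a : ℚ, ∀ y : complexBetti S (2 * 1),
          (∀ d ∈ algebraicClasses S 1, cupProduct (rfl : 2 * 1 + 2 * 1 = 2 * 2) y d = 0) →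
            f y = (a : ℂ) • y) →
      ∀ (f : complexBetti S (2 * 1) →ₗ[ℂ] complexBetti S (2 * 1)),
        (∀ y, IsRationalClass y → IsRationalClass (f y)) →
        (∀ (i j : ℕ) y, IsOfHodgeType 2 S (2 * 1) i j y → IsOfHodgeType 2 S (2 * 1) i j (f y)) →
        (∀ d ∈ algebraicClasses S 1, f d = 0) →
        (∀ y : complexBetti S (2 * 1), ∀ d ∈ algebraicClasses S 1,
          cupProduct (rfl : 2 * 1 + 2 * 1 = 2 * 2) (f y) d = 0) →
        ∃ g : complexBetti S (2 * 1) →ₗ[ℂ] complexBetti S (2 * 1),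
          (∀ d ∈ algebraicClasses S 1, g d ∈ algebraicClasses S 1) ∧
          (∃ γ ∈ algebraicClasses (S ⊗ S) 2, ∀ y : complexBetti S (2 * 1),
            g y = Corr[complexOrientationFamily, hS.isSmoothProjective ; γ, y]) ∧
          ∀ y : complexBetti S (2 * 1),
            (∀ d ∈ algebraicClasses S 1, cupProduct (rfl : 2 * 1 + 2 * 1 = 2 * 2) y d = 0) →
              f y = g y) :
    Summit.HodgeConjecture.HodgeConjecture.Theses.MarkmanPartnerTransport.PicardThreeK3Squares := by
  intro S hS η p x _ hρ
  by_cases hCM : HasComplexMultiplication S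
  · exact hodgeConjectureFor_square_of_CM_of_buskin hB hmark S hS hCM
  · by_cases hQ : ∀ (f : complexBetti S (2 * 1) →ₗ[ℂ] complexBetti S (2 * 1)),
        (∀ y, IsRationalClass y → IsRationalClass (f y)) →
        (∀ (i j : ℕ) y, IsOfHodgeType 2 S (2 * 1) i j y → IsOfHodgeType 2 S (2 * 1) i j (f y)) →
        (∀ d ∈ algebraicClasses S 1, f d = 0) →
        (∀ y : complexBetti S (2 * 1), ∀ d ∈ algebraicClasses S 1,
          cupProduct (rfl : 2 * 1 + 2 * 1 = 2 * 2) (f y) d = 0) →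
        ∃ a : ℚ, ∀ y : complexBetti S (2 * 1),
          (∀ d ∈ algebraicClasses S 1, cupProduct (rfl : 2 * 1 + 2 * 1 = 2 * 2) y d = 0) →
            f y = (a : ℂ) • y
    · exact SquareGlueFree.hodgeConjectureFor_square_of_hodgeEndomorphisms_scalar hS.isSmoothProjective hQ
    · exact hodgeConjectureFor_square_of_cycleInducedSector complexOrientationFamily hS.isSmoothProjective
        (hRM S hS hCM hρ hQ)

end Summit.HodgeConjecture.HodgeConjecture.Theorems.MarkmanPartnerTransport.CMThird

end
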